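import Literature.MathematicalPhysics.QuantumFieldTheory.Balaban1983to89.B11Eq118RegimeRadii

/-!
# `Balaban1983to89.B11Eq143LinearTermRadii` — T. Bałaban, *The variational problem and background fields in renormalization group method for lattice
# gauge theories*, Commun. Math. Phys. **102** (1985) 277–309 [Balaban1985Variational]: Prop. 6 (117)–(121) p. 295 WITH THE OPTIONAL LINEAR TERM of
# (143) p. 300 / (179)–(180) p. 306 — THE SMALLNESS LETTERS OF THE CONTRACTION REGIME WITH A LINEAR SLOT `Λ` ARE SATISFIABLE WHENEVER `‖Λ‖ < 1`: given
# bounded `𝒢`, `Λ` with `‖Λ‖ < 1` and a quadratic-analytic `W`, radii `j, a, ε₄ > 0` (below any cap) inhabiting lit-balaban's `B11Eq174Chart.Regime 𝒢 Λ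
# W ‖𝒢‖ ‖Λ‖ C₄ a₃ j a ε₄` EXIST — «Proposition 6 is valid for it also» made explicit at the level of the scalar conditions

statement-level skeleton of published theorems with citation tags; proofs where landed; nothing here is a claim about the Yang–Mills mass gap

PDF held: `paper:balaban1985-cmp102-variational-background` (journal page = PDF page + 276); p. 295 (117)–(121), p. 300 (143) and p. 306 (179)–(180)
read by this seat (2026-08-22) from the render-verified transcript `pub-balaban/b2b-balaban-b11/transcript.md` and through the verbatim
quotations of `B11Eq174Chart` / `B11Eq118RegimeRadii`.

CITATION HEADER (lean-in-tree rule 2026-08-18).  WHAT IS REPRODUCED: p. 300, *«A₀ = −G̃J + G̃Δ^{(2)}(A₀ + H₀B) − G̃((δ/δA′)V)(A₀ + H₀B). (143)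
This equation has all the properties of Eq. (111) and Proposition 6 is valid for it also.»*; p. 306, *«𝒜₀ − G̃Δ^{(2)}(𝒜₀ + H₀B) +
G̃((δ/δA′)V)(𝒜₀ + H₀B) = 0.  We may simplify this equation including the operator −Δ^{(2)} into the definition of G … Using this new operator G
we obtain the equation … (180) It is an equation of the same type as (175)»* — i.e. the fixed-point scheme of Prop. 6 carries an OPTIONAL LINEAR
TERM (here `G̃Δ^{(2)}`), which one may either keep in the equation ((143)) or absorb into the Green's function ((180)).  lit-balaban's
`B11Prop6Scheme.mapT 𝒢 Λ W J` / `B11Eq174Chart.Regime 𝒢 Λ W B₀ θ C₄ a₃ j a ε₄` type exactly this: `norm_L : ‖ΛY‖ ≤ θ‖Y‖`, the self-map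
condition (118) with `+ θ(ε₄ + a)` and the contraction condition (121) with `θ +`.  The row owner's `B11Eq118RegimeRadii` chose the radii for
`θ = 0` only (`Regime.of_opNorm_zeroLinear`, `exists_regime_radii`); THIS FILE does the same WITH the linear slot: the one new arithmetic fact
is that (118)/(121) remain jointly satisfiable iff the linear term is a strict contraction, `θ < 1` — print's «for ε₁ sufficiently small»
(in print `θ` is O(1)·(a small parameter): (3.137) of [5] for `Δ^{(2)}`, or `O(ε₁)` for a current-dependent linear term).

WHY THIS FILE (cell context, pub-balaban NE9, route R2′).  The desk's trigger T23 «ONE INSTANCE» (PRICING-NE9 v29/v30) asks for the chart of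
`cur U` with the (L3) letter `W80` in the W-slot AND the (79)/(3.127) J-term PLACED — on the road where the chain's `𝔊` inverts the BARE
Hessian ([B9] (3.26)), the J-79 cross term `L_J = −((HC^{(2)})′(·))ᵗJ` (`B11Eq79LinearTerm.LJ`, a continuous LINEAR map) goes into the
scheme's linear slot `Λ := −𝔊 ∘L L_J` — exactly the situation of (143).  The composite chart (174)∘(47) is assembled by
`NE9B11ChartAnalytic.chartHB_triple_of_twoRegimes`, already generic in `Λ`; what was missing is the CHOICE OF RADII for `Λ ≠ 0`.

WHAT IS PROVED (sorry-free; real arithmetic + operator norms; no `Prop` placeholder, no definition, no inequality of the paper asserted).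
* `regime_of_opNorm_linear` — `Regime 𝒢 Λ W ‖𝒢‖ ‖Λ‖ C₄ a₃ j a ε₄` from the three scalar conditions `dom`/`self`/`contr` (B₀ := ‖𝒢‖, θ := ‖Λ‖).
* **`exists_regime_radii_linear`** — given `QuadAnalytic W C₄ a₃` (`0 ≤ C₄`, `0 < a₃`), `‖Λ‖ < 1` and a cap `δ > 0`: `∃ j₀ a ε₄ > 0` with
  `ε₄ + a ≤ δ` and `Regime 𝒢 Λ W ‖𝒢‖ ‖Λ‖ C₄ a₃ j a ε₄` for every current letter `0 ≤ j ≤ j₀` (explicit: with `s := 1 − ‖Λ‖`,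
  `ε₄ := min(a₃/4, δ/2, s/(16(‖𝒢‖C₄ + 1)))`, `a := s·ε₄/(4(‖Λ‖ + 1))`, `j₀ := s·ε₄/(4(‖𝒢‖ + 1))`).
* `exists_regime_radii_linear_of_le` — the same for any displayed bound `‖Λ‖ ≤ θ < 1` in the `θ`-slot (`Regime 𝒢 Λ W ‖𝒢‖ θ …`).
* `not_regime_of_one_le` — conversely NO regime exists with `1 ≤ θ` (the contraction condition (121) forces `θ < 1`): the hypothesis is sharp.
MODEL / HONEST SCOPE.  Abstract complex normed spaces and continuous linear maps, as in `B11Eq174Chart`; EXISTENCE of admissible radii only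
(non-uniform: the constants are the operator norms of the given maps); which road a consumer takes ((143): keep `Λ`; (180): absorb it into
`G`) is not decided here; NOT summit progress (cell pub-balaban: NE9 NOT PRINTED / NOT PROVED; «NE9 ⇐ the named binders»; spine PROVED 0/9;
HONEST DEPENDENCY: continuum YM on T⁴ ⇐ BetaPertH ∧ nine spine estimates (0/9 proved); BetaPertH ⇐ (D1) ∧ (D4) ∧ CAP+tail; G-an2-4 gates
asym, D1 and NE2/3/4).  Unit `b2b-balaban-t4-ne9-formalise-leaf-05` (NE9 crux-team leaf prover, gen 66).  Imports `B11Eq118RegimeRadii` ONLY;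
modifies nothing.  Net new unproved facts: 0.
-/

noncomputable section

namespace Literature.MathematicalPhysics.QuantumFieldTheory.Balaban1983to89.B11Eq143LinearTermRadii

open Metric Set
open Literature.MathematicalPhysics.QuantumFieldTheory.Balaban1983to89
open Literature.MathematicalPhysics.QuantumFieldTheory.Balaban1983to89.B13Contraction113 (QuadAnalytic)
open Literature.MathematicalPhysics.QuantumFieldTheory.Balaban1983to89.B11Eq174Chart (Regime)

variable {𝒴 𝒵 : Type*} [NormedAddCommGroup 𝒴] [NormedSpace ℂ 𝒴] [NormedAddCommGroup 𝒵] [NormedSpace ℂ 𝒵]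

/-- **A regime WITH the linear term, from the three scalar conditions** (`B₀ := ‖𝒢‖`, `θ := ‖Λ‖`): the operator bounds `‖𝒢f‖ ≤ ‖𝒢‖‖f‖`,
`‖ΛY‖ ≤ ‖Λ‖‖Y‖` are the operator norms', the domain condition `2(ε₄ + a) ≤ a₃` ((121) first member), the self-map condition (118) with the
linear term and the contraction condition (121) with `θ` are hypotheses. [cite: Balaban1985Variational, Prop. 6 (117)–(121) p.295, (143) p.300] -/
theorem regime_of_opNorm_linear (𝒢 : 𝒵 →L[ℂ] 𝒴) (Λ : 𝒴 →L[ℂ] 𝒴) {W : 𝒴 → 𝒵} {C₄ a₃ j a ε₄ : ℝ} (hW : QuadAnalytic W C₄ a₃)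
    (hC₄ : 0 ≤ C₄) (hε₄ : 0 ≤ ε₄) (hdom : 2 * (ε₄ + a) ≤ a₃)
    (hself : ‖𝒢‖ * j + ‖Λ‖ * (ε₄ + a) + ‖𝒢‖ * C₄ * (ε₄ + a) ^ 2 ≤ ε₄) (hcontr : ‖Λ‖ + 4 * ‖𝒢‖ * C₄ * (ε₄ + a) < 1) :
    Regime 𝒢 Λ W ‖𝒢‖ ‖Λ‖ C₄ a₃ j a ε₄ :=
  ⟨fun f => 𝒢.le_opNorm f, fun Y => Λ.le_opNorm Y, hW, norm_nonneg _, hC₄, norm_nonneg _, hε₄, hdom, hself, hcontr⟩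

/-- **THE RADII OF A REGIME WITH A STRICTLY CONTRACTING LINEAR TERM CAN BE CHOSEN** below any cap `δ > 0`, uniformly for all current letters
`0 ≤ j ≤ j₀` with an explicit `j₀ > 0`, for any displayed bound `‖ΛY‖ ≤ θ‖Y‖` with `0 ≤ θ < 1`: with `s := 1 − θ`,
`ε₄ := min(a₃/4, δ/2, s/(16(‖𝒢‖C₄ + 1)))`, `a := s·ε₄/(4(θ + 1))`, `j₀ := s·ε₄/(4(‖𝒢‖ + 1))` — then `‖𝒢‖j ≤ sε₄/4`, `θ·a ≤ sε₄/4`,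
`‖𝒢‖C₄(ε₄ + a)² ≤ 4‖𝒢‖C₄ε₄² ≤ sε₄/4` give (118) `… ≤ θε₄ + ¾sε₄ ≤ ε₄`, and `θ + 4‖𝒢‖C₄(ε₄ + a) ≤ θ + s/2 < 1` gives (121) — print's
«Proposition 6 is valid for it also» / «for ε₁ sufficiently small», for the equation (143) with its linear term kept.
[cite: Balaban1985Variational, Prop. 6 (118), (121) p.295, (143) p.300, (180) p.306] -/
theorem exists_regime_radii_linear_of_le (𝒢 : 𝒵 →L[ℂ] 𝒴) (Λ : 𝒴 →L[ℂ] 𝒴) {W : 𝒴 → 𝒵} {C₄ a₃ : ℝ} (hW : QuadAnalytic W C₄ a₃)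
    (hC₄ : 0 ≤ C₄) (ha₃ : 0 < a₃) {θ : ℝ} (hΛ : ∀ Y, ‖Λ Y‖ ≤ θ * ‖Y‖) (hθ0 : 0 ≤ θ) (hθ : θ < 1) {δ : ℝ} (hδ : 0 < δ) :
    ∃ j₀ a ε₄ : ℝ, 0 < j₀ ∧ 0 < a ∧ 0 < ε₄ ∧ ε₄ + a ≤ δ ∧ ∀ j, 0 ≤ j → j ≤ j₀ → Regime 𝒢 Λ W ‖𝒢‖ θ C₄ a₃ j a ε₄ := by
  set B₀ : ℝ := ‖𝒢‖ with hB₀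
  have hB₀0 : 0 ≤ B₀ := norm_nonneg _
  set s : ℝ := 1 - θ with hs
  have hs0 : 0 < s := by rw [hs]; linarith
  have hs1 : s ≤ 1 := by rw [hs]; linarith
  have hK : 0 < B₀ * C₄ + 1 := by positivity
  set ε₄ : ℝ := min (a₃ / 4) (min (δ / 2) (s / (16 * (B₀ * C₄ + 1)))) with hε₄def
  have hε₄0 : 0 < ε₄ := by
    rw [hε₄def]; exact lt_min (by positivity) (lt_min (by positivity) (by positivity))
  have hε₄a : ε₄ ≤ a₃ / 4 := min_le_left _ _
  have hε₄δ : ε₄ ≤ δ / 2 := (min_le_right _ _).trans (min_le_left _ _)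
  have hε₄K : ε₄ ≤ s / (16 * (B₀ * C₄ + 1)) := (min_le_right _ _).trans (min_le_right _ _)
  -- `16 B₀C₄ ε₄ ≤ s`
  have hprod : 16 * (B₀ * C₄) * ε₄ ≤ s := by
    have h1 : 16 * (B₀ * C₄ + 1) * ε₄ ≤ s := by
      rw [le_div_iff₀ (by positivity)] at hε₄K; linarith
    nlinarith
  set a : ℝ := s * ε₄ / (4 * (θ + 1)) with ha
  have ha0 : 0 < a := by positivity
  -- `a ≤ ε₄` (since `s ≤ 1 ≤ 4(θ + 1)`), `θ·a ≤ sε₄/4`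
  have haε : a ≤ ε₄ := by
    rw [ha, div_le_iff₀ (by positivity)]; nlinarith
  have hθa : θ * a ≤ s * ε₄ / 4 := by
    rw [ha, mul_div_assoc', div_le_div_iff₀ (by positivity) (by positivity)]; nlinarith
  refine ⟨s * ε₄ / (4 * (B₀ + 1)), a, ε₄, by positivity, ha0, hε₄0, by linarith, fun j hj0 hj => ?_⟩
  refine ⟨fun f => 𝒢.le_opNorm f, hΛ, hW, hB₀0, hC₄, hθ0, hε₄0.le, by linarith, ?_, ?_⟩
  · -- (118) with the linear term: `B₀ j + θ(ε₄ + a) + B₀C₄(ε₄ + a)² ≤ sε₄/4 + θε₄ + sε₄/4 + sε₄/4 ≤ ε₄`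
    have h1 : B₀ * j ≤ s * ε₄ / 4 := by
      have : B₀ * j ≤ B₀ * (s * ε₄ / (4 * (B₀ + 1))) := mul_le_mul_of_nonneg_left hj hB₀0
      refine this.trans ?_
      rw [mul_div_assoc', div_le_div_iff₀ (by positivity) (by positivity)]
      nlinarith [mul_nonneg hB₀0 (mul_nonneg hs0.le hε₄0.le)]
    have h2 : B₀ * C₄ * (ε₄ + a) ^ 2 ≤ s * ε₄ / 4 := by
      have hsq : (ε₄ + a) ^ 2 ≤ 4 * ε₄ ^ 2 := by nlinarith
      have hBC : 0 ≤ B₀ * C₄ := mul_nonneg hB₀0 hC₄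
      calc B₀ * C₄ * (ε₄ + a) ^ 2 ≤ B₀ * C₄ * (4 * ε₄ ^ 2) := mul_le_mul_of_nonneg_left hsq hBC
        _ = (16 * (B₀ * C₄) * ε₄) * ε₄ / 4 := by ring
        _ ≤ s * ε₄ / 4 := by gcongr
    have h3 : θ * (ε₄ + a) = θ * ε₄ + θ * a := by ring
    have h4 : θ * ε₄ = ε₄ - s * ε₄ := by rw [hs]; ring
    have h5 : 0 ≤ s * ε₄ := by positivity
    rw [h3]
    linarith [h1, h2, hθa, h4, h5]
  · -- (121) second member with `θ`: `θ + 4B₀C₄(ε₄ + a) ≤ θ + 8B₀C₄ε₄ ≤ θ + s/2 < 1`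
    have hBC : 0 ≤ B₀ * C₄ := mul_nonneg hB₀0 hC₄
    have h5 : 4 * B₀ * C₄ * (ε₄ + a) ≤ 8 * (B₀ * C₄) * ε₄ := by nlinarith
    have h6 : θ = 1 - s := by rw [hs]; ring
    rw [h6]
    linarith [h5, hprod]

/-- **The same with `θ := ‖Λ‖`** (the operator norm in the `θ`-slot): radii exist as soon as `‖Λ‖ < 1`.
[cite: Balaban1985Variational, Prop. 6 (118), (121) p.295, (143) p.300] -/
theorem exists_regime_radii_linear (𝒢 : 𝒵 →L[ℂ] 𝒴) (Λ : 𝒴 →L[ℂ] 𝒴) {W : 𝒴 → 𝒵} {C₄ a₃ : ℝ} (hW : QuadAnalytic W C₄ a₃)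
    (hC₄ : 0 ≤ C₄) (ha₃ : 0 < a₃) (hΛ : ‖Λ‖ < 1) {δ : ℝ} (hδ : 0 < δ) :
    ∃ j₀ a ε₄ : ℝ, 0 < j₀ ∧ 0 < a ∧ 0 < ε₄ ∧ ε₄ + a ≤ δ ∧ ∀ j, 0 ≤ j → j ≤ j₀ → Regime 𝒢 Λ W ‖𝒢‖ ‖Λ‖ C₄ a₃ j a ε₄ :=
  exists_regime_radii_linear_of_le 𝒢 Λ hW hC₄ ha₃ (fun Y => Λ.le_opNorm Y) (norm_nonneg _) hΛ hδ

/-- **The strict contraction of the linear term is NECESSARY**: no `Regime 𝒢 Λ W B₀ θ C₄ a₃ j a ε₄` has `1 ≤ θ` (the contraction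
condition (121) reads `θ + 4B₀C₄(ε₄ + a) < 1` with `B₀, C₄ ≥ 0` and `ε₄ + a ≥ 0` forced by the other members when `0 ≤ a`).
[cite: Balaban1985Variational, Prop. 6 (121) p.295] -/
theorem not_regime_of_one_le {𝒢 : 𝒵 →L[ℂ] 𝒴} {Λ : 𝒴 →L[ℂ] 𝒴} {W : 𝒴 → 𝒵} {B₀ θ C₄ a₃ j a ε₄ : ℝ} (ha : 0 ≤ a) (hθ : 1 ≤ θ) :
    ¬ Regime 𝒢 Λ W B₀ θ C₄ a₃ j a ε₄ := by
  intro R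
  have h1 : 0 ≤ 4 * B₀ * C₄ * (ε₄ + a) := by
    have := R.B₀_nonneg; have := R.C₄_nonneg; have := R.ε₄_nonneg; positivity
  linarith [R.contr]

end Literature.MathematicalPhysics.QuantumFieldTheory.Balaban1983to89.B11Eq143LinearTermRadii

end
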